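import Mathlib
import Summits.CriticalPhenomena.PercolationContinuityZ3.Theorems.PercNearOneGluingNoHeavyLowerTailOrientedAntipodalHallTwoSidedCertificateCoInt

/-!
# Co-intersecting two-sided certificates: instances (three petals: T5, T4, T4'; four petals: the two maximal classes)

Helper file for crux `stmt-CriticalPhenomena-4575` (`NoHeavyLowerTail`, route `PercNearOneGluingNoHeavy`), hull-port seat
`prim-hp-7` (generation 54); `--supports stmt-CriticalPhenomena-4575`.  Everything here is PROVED: each theorem is an instance
of `OrientedAntipodalHall.exists_injective_good_above_of_twoSidedTableCoInt` (file `…TwoSidedCertificateCoInt`) with an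
explicit label-level certificate checked by `decide`.  Setting: `f : Finset α → Lab k` monotone, `D` a CO-INTERSECTING family
of antipodal bads of `S` (opposite types allowed), goods `U ⊆ S` with `f U = A`, `f (S \\ U) = B`; conclusion: distinct good
representatives above the bads (IC/CoI-Kleitman for the type class).

REACH of the label-level co-intersecting certificate (search `prim-hp-7/code/gen54/lablevel.py`, `lab4.py`; memo
`prim-hp-7/FROM-prim-hp-7-g54-THREE-PETALS.md`): on THREE petals the classes that are neither bipartite (prim-hp-7 gen 50,
`JBern.card_filter_le_card_filter_target_of_union_ne_univ`) nor opposite-free (prim-ineq-gen-3) are `T4'`, `T4`, `T5`, `T6` up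
to symmetry; the first three are certified (below; `T5 ⊇ T4, T4'`), the full class `T6` has NO label-level certificate.  On
FOUR petals, of the 89 classes that are non-bipartite and contain an opposite pair, 63 are certified — exactly the sub-classes
(up to renaming petals and reversing all types) of the two maximal classes `M1`, `M2` below —, 13 contain `T6`, and 13 more
have no label-level certificate (minimal ones: `{01,02,10,12,23,30,31}` and five 8-type classes).  (prim-hp-7 gen 54, 2026-08-22.)
-/

namespace Summit.CriticalPhenomena.PercolationContinuityZ3.Theorems

namespace OrientedAntipodalHall

open Finset AntipodalStrongHarris AntipodalStrongHarris.Lab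
open scoped FinsetFamily

variable {α : Type*} [DecidableEq α]

/-- CoI-Kleitman for the five-type class `T5 = {01, 02, 10, 12, 20}` on three petals (two opposite pairs at petal 0 and the arc 1→2; contains `T4 = {01,10} + 0→2→…` and `T4'` up to symmetry) — the label-level form of `card_le_card_goods_above_of_coint_fiveTypes` (file `…CoIntThreePetals`).  Certificate: plain types [(0, 1), (0, 2)]; R = [], S₀ = [2]; block order C(1,2)=Φ2 ≺ C(1,0)=C(2,0) ≺ P(0,1)=P(0,2) (`C(p,q)` = complemented members of type `(p,q)`, `P(p,q)` = plain members, `Ψr`/`Φs` = pseudo-classes; `=` joins blocks of equal rank). [this work] -/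
theorem exists_injective_good_above_coint_threePetals_T5 (S : Finset α) {f : Finset α → Lab 3}
    (hf : ∀ ⦃X Y : Finset α⦄, X ⊆ Y → f X ≤ f Y) (D : Finset (Finset α)) (i j : Finset α → Fin 3)
    (hDS : ∀ X ∈ D, X ⊆ S) (hDi : ∀ X ∈ D, f X = petal (i X)) (hDj : ∀ X ∈ D, f (S \ X) = petal (j X))
    (hT : ∀ X ∈ D, (i X, j X) ∈ ({((0 : Fin 3), (1 : Fin 3)), ((0 : Fin 3), (2 : Fin 3)), ((1 : Fin 3), (0 : Fin 3)), ((1 : Fin 3), (2 : Fin 3)), ((2 : Fin 3), (0 : Fin 3))} : Finset (Fin 3 × Fin 3)))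
    (hco : ∀ X ∈ D, ∀ X' ∈ D, X ∪ X' ≠ S) :
    ∃ φ : D → Finset α, Function.Injective φ ∧
      ∀ X : D, (X : Finset α) ⊆ φ X ∧ φ X ⊆ S ∧ f (φ X) = top ∧ f (S \ φ X) = bot :=
  exists_injective_good_above_of_twoSidedTableCoInt _
    (fun p q => (![![false, true, true], ![false, false, false], ![false, false, false]] : Fin 3 → Fin 3 → Bool) p q)
    (∅ : Finset (Fin 3)) ({(2 : Fin 3)} : Finset (Fin 3))
    (fun p q => (![![0, 2, 2], ![1, 0, 0], ![1, 0, 0]] : Fin 3 → Fin 3 → ℕ) p q)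
    (fun r => (![0, 0, 0] : Fin 3 → ℕ) r) (fun s => (![0, 0, 0] : Fin 3 → ℕ) s)
    ⟨by decide, by decide, by decide⟩ S hf D i j hDS hDi hDj hT hco

/-- CoI-Kleitman for `T4' = {01, 02, 10, 12}` on three petals (opposite pair {01,10} and both arcs into petal 2).  Certificate: plain types [(0, 1)]; R = [0], S₀ = []; block order C(0,2)=Ψ0 ≺ C(1,0)=C(1,2) ≺ P(0,1) (`C(p,q)` = complemented members of type `(p,q)`, `P(p,q)` = plain members, `Ψr`/`Φs` = pseudo-classes; `=` joins blocks of equal rank). [this work] -/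
theorem exists_injective_good_above_coint_threePetals_T4p (S : Finset α) {f : Finset α → Lab 3}
    (hf : ∀ ⦃X Y : Finset α⦄, X ⊆ Y → f X ≤ f Y) (D : Finset (Finset α)) (i j : Finset α → Fin 3)
    (hDS : ∀ X ∈ D, X ⊆ S) (hDi : ∀ X ∈ D, f X = petal (i X)) (hDj : ∀ X ∈ D, f (S \ X) = petal (j X))
    (hT : ∀ X ∈ D, (i X, j X) ∈ ({((0 : Fin 3), (1 : Fin 3)), ((0 : Fin 3), (2 : Fin 3)), ((1 : Fin 3), (0 : Fin 3)), ((1 : Fin 3), (2 : Fin 3))} : Finset (Fin 3 × Fin 3)))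
    (hco : ∀ X ∈ D, ∀ X' ∈ D, X ∪ X' ≠ S) :
    ∃ φ : D → Finset α, Function.Injective φ ∧
      ∀ X : D, (X : Finset α) ⊆ φ X ∧ φ X ⊆ S ∧ f (φ X) = top ∧ f (S \ φ X) = bot :=
  exists_injective_good_above_of_twoSidedTableCoInt _
    (fun p q => (![![false, true, false], ![false, false, false], ![false, false, false]] : Fin 3 → Fin 3 → Bool) p q)
    ({(0 : Fin 3)} : Finset (Fin 3)) (∅ : Finset (Fin 3))
    (fun p q => (![![0, 2, 0], ![1, 0, 1], ![0, 0, 0]] : Fin 3 → Fin 3 → ℕ) p q)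
    (fun r => (![0, 0, 0] : Fin 3 → ℕ) r) (fun s => (![0, 0, 0] : Fin 3 → ℕ) s)
    ⟨by decide, by decide, by decide⟩ S hf D i j hDS hDi hDj hT hco

/-- CoI-Kleitman for `T4 = {01, 02, 10, 21}` on three petals (opposite pair {01,10} and the 2-path 0→2→1).  Certificate: plain types [(0, 1)]; R = [0], S₀ = [1, 2]; block order C(0,2)=Φ2=Ψ0 ≺ C(2,1)=Φ1 ≺ C(1,0) ≺ P(0,1) (`C(p,q)` = complemented members of type `(p,q)`, `P(p,q)` = plain members, `Ψr`/`Φs` = pseudo-classes; `=` joins blocks of equal rank). [this work] -/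
theorem exists_injective_good_above_coint_threePetals_T4 (S : Finset α) {f : Finset α → Lab 3}
    (hf : ∀ ⦃X Y : Finset α⦄, X ⊆ Y → f X ≤ f Y) (D : Finset (Finset α)) (i j : Finset α → Fin 3)
    (hDS : ∀ X ∈ D, X ⊆ S) (hDi : ∀ X ∈ D, f X = petal (i X)) (hDj : ∀ X ∈ D, f (S \ X) = petal (j X))
    (hT : ∀ X ∈ D, (i X, j X) ∈ ({((0 : Fin 3), (1 : Fin 3)), ((0 : Fin 3), (2 : Fin 3)), ((1 : Fin 3), (0 : Fin 3)), ((2 : Fin 3), (1 : Fin 3))} : Finset (Fin 3 × Fin 3)))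
    (hco : ∀ X ∈ D, ∀ X' ∈ D, X ∪ X' ≠ S) :
    ∃ φ : D → Finset α, Function.Injective φ ∧
      ∀ X : D, (X : Finset α) ⊆ φ X ∧ φ X ⊆ S ∧ f (φ X) = top ∧ f (S \ φ X) = bot :=
  exists_injective_good_above_of_twoSidedTableCoInt _
    (fun p q => (![![false, true, false], ![false, false, false], ![false, false, false]] : Fin 3 → Fin 3 → Bool) p q)
    ({(0 : Fin 3)} : Finset (Fin 3)) ({(1 : Fin 3), (2 : Fin 3)} : Finset (Fin 3))
    (fun p q => (![![0, 3, 0], ![2, 0, 0], ![0, 1, 0]] : Fin 3 → Fin 3 → ℕ) p q)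
    (fun r => (![0, 0, 0] : Fin 3 → ℕ) r) (fun s => (![0, 1, 0] : Fin 3 → ℕ) s)
    ⟨by decide, by decide, by decide⟩ S hf D i j hDS hDi hDj hT hco

/-- CoI-Kleitman for the first maximal certified class on four petals `M1 = {01,02,03,10,12,13,20,23,30}` (petal 0 opposite to 1, 2, 3; transitive triangle 1→2→3, 1→3).  Every type class on four petals with a label-level co-intersecting two-sided certificate is, up to renaming petals and reversing types, a sub-class of `M1` or of `M2` below (search `prim-hp-7/code/gen54/lab4.py`: 63 of the 89 non-bipartite classes with an opposite pair).  Certificate: plain types [(0, 1), (0, 2), (0, 3)]; R = [], S₀ = [2, 3]; block order C(1,2)=C(1,3)=Φ2 ≺ C(2,3)=Φ3 ≺ C(1,0)=C(2,0)=C(3,0) ≺ P(0,1)=P(0,2)=P(0,3) (`C(p,q)` = complemented members of type `(p,q)`, `P(p,q)` = plain members, `Ψr`/`Φs` = pseudo-classes; `=` joins blocks of equal rank). [this work] -/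
theorem exists_injective_good_above_coint_fourPetals_M1 (S : Finset α) {f : Finset α → Lab 4}
    (hf : ∀ ⦃X Y : Finset α⦄, X ⊆ Y → f X ≤ f Y) (D : Finset (Finset α)) (i j : Finset α → Fin 4)
    (hDS : ∀ X ∈ D, X ⊆ S) (hDi : ∀ X ∈ D, f X = petal (i X)) (hDj : ∀ X ∈ D, f (S \ X) = petal (j X))
    (hT : ∀ X ∈ D, (i X, j X) ∈ ({((0 : Fin 4), (1 : Fin 4)), ((0 : Fin 4), (2 : Fin 4)), ((0 : Fin 4), (3 : Fin 4)), ((1 : Fin 4), (0 : Fin 4)), ((1 : Fin 4), (2 : Fin 4)), ((1 : Fin 4), (3 : Fin 4)), ((2 : Fin 4), (0 : Fin 4)), ((2 : Fin 4), (3 : Fin 4)), ((3 : Fin 4), (0 : Fin 4))} : Finset (Fin 4 × Fin 4)))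
    (hco : ∀ X ∈ D, ∀ X' ∈ D, X ∪ X' ≠ S) :
    ∃ φ : D → Finset α, Function.Injective φ ∧
      ∀ X : D, (X : Finset α) ⊆ φ X ∧ φ X ⊆ S ∧ f (φ X) = top ∧ f (S \ φ X) = bot :=
  exists_injective_good_above_of_twoSidedTableCoInt _
    (fun p q => (![![false, true, true, true], ![false, false, false, false], ![false, false, false, false], ![false, false, false, false]] : Fin 4 → Fin 4 → Bool) p q)
    (∅ : Finset (Fin 4)) ({(2 : Fin 4), (3 : Fin 4)} : Finset (Fin 4))
    (fun p q => (![![0, 3, 3, 3], ![2, 0, 0, 0], ![2, 0, 0, 1], ![2, 0, 0, 0]] : Fin 4 → Fin 4 → ℕ) p q)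
    (fun r => (![0, 0, 0, 0] : Fin 4 → ℕ) r) (fun s => (![0, 0, 0, 1] : Fin 4 → ℕ) s)
    ⟨by decide, by decide, by decide⟩ S hf D i j hDS hDi hDj hT hco

/-- CoI-Kleitman for the second maximal certified class on four petals `M2 = {01,02,03,10,12,21,23,30,32}` (opposite pairs {01,10}, {03,30}, {12,21}, {23,32} — a 4-cycle of opposite pairs — and the chord 0→2).  Certificate: plain types [(0, 1), (0, 3), (2, 1), (2, 3)]; R = [0], S₀ = []; block order C(0,2)=Ψ0 ≺ C(1,0)=C(1,2)=C(3,0)=C(3,2) ≺ P(0,1)=P(0,3)=P(2,1)=P(2,3) (`C(p,q)` = complemented members of type `(p,q)`, `P(p,q)` = plain members, `Ψr`/`Φs` = pseudo-classes; `=` joins blocks of equal rank). [this work] -/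
theorem exists_injective_good_above_coint_fourPetals_M2 (S : Finset α) {f : Finset α → Lab 4}
    (hf : ∀ ⦃X Y : Finset α⦄, X ⊆ Y → f X ≤ f Y) (D : Finset (Finset α)) (i j : Finset α → Fin 4)
    (hDS : ∀ X ∈ D, X ⊆ S) (hDi : ∀ X ∈ D, f X = petal (i X)) (hDj : ∀ X ∈ D, f (S \ X) = petal (j X))
    (hT : ∀ X ∈ D, (i X, j X) ∈ ({((0 : Fin 4), (1 : Fin 4)), ((0 : Fin 4), (2 : Fin 4)), ((0 : Fin 4), (3 : Fin 4)), ((1 : Fin 4), (0 : Fin 4)), ((1 : Fin 4), (2 : Fin 4)), ((2 : Fin 4), (1 : Fin 4)), ((2 : Fin 4), (3 : Fin 4)), ((3 : Fin 4), (0 : Fin 4)), ((3 : Fin 4), (2 : Fin 4))} : Finset (Fin 4 × Fin 4)))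
    (hco : ∀ X ∈ D, ∀ X' ∈ D, X ∪ X' ≠ S) :
    ∃ φ : D → Finset α, Function.Injective φ ∧
      ∀ X : D, (X : Finset α) ⊆ φ X ∧ φ X ⊆ S ∧ f (φ X) = top ∧ f (S \ φ X) = bot :=
  exists_injective_good_above_of_twoSidedTableCoInt _
    (fun p q => (![![false, true, false, true], ![false, false, false, false], ![false, true, false, true], ![false, false, false, false]] : Fin 4 → Fin 4 → Bool) p q)
    ({(0 : Fin 4)} : Finset (Fin 4)) (∅ : Finset (Fin 4))
    (fun p q => (![![0, 2, 0, 2], ![1, 0, 1, 0], ![0, 2, 0, 2], ![1, 0, 1, 0]] : Fin 4 → Fin 4 → ℕ) p q)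
    (fun r => (![0, 0, 0, 0] : Fin 4 → ℕ) r) (fun s => (![0, 0, 0, 0] : Fin 4 → ℕ) s)
    ⟨by decide, by decide, by decide⟩ S hf D i j hDS hDi hDj hT hco

end OrientedAntipodalHall

end Summit.CriticalPhenomena.PercolationContinuityZ3.Theorems
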